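import Summits.BirchSwinnertonDyer.Rank1Residual.AdditivePotMult.ShaIsotropicCasselsTate
import Summits.BirchSwinnertonDyer.Rank1Residual.SecondDescent.BSDpFromSecondDescentNonempty
import Summits.BirchSwinnertonDyer.Rank1Residual.AdditivePotMult.RankZeroShaCertificate
import HarnessLib

/-!
# The isotropic Cassels–Tate road in `Ш`-LEVEL currency (`#Ш[p] = p^d` instead of `#Sel^(p)`), and
# its twins for the supersingular classes' `#Ш_an = 81` rows (X6 / X7 / X8 at `p = 3`) — offered to the
# class-closure instrument B-1 / cc-eng-4 and additive-p3 (cell `b2b-bsdres`, sub-cell additive-p1,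
# gen 17; per-pair TOOL theorems)

HONEST FRAMING (cell `b2b-bsdres`, run/shared/lean/b2b/bsd-rank1-residual/, verbatim in every
file): the goal of the cell is to DELETE the COMBINATION-SHAPED residual classes of the
Birch–Swinnerton-Dyer formula for ALL analytic-rank `≤ 1` elliptic curves over `ℚ` — "full BSD
formula for every rank `≤ 1` curve in class `C`" assembled STRICTLY from published theorems — so
that the rank-`≤ 1` remainder becomes exactly the CONSTRUCTION-SHAPED classes, which are TYPED
(missing-input `Prop`s), NOT attempted. This is not "finishing BSD". X6/X7/X8 and X3♯(M)/X4(M)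
stay CONSTRUCTION-SHAPED; per-pair certificate consumers; nothing booked (the lane books); rows
named are EVIDENCE pointers. THEOREMS ONLY (no definition, no named fact, no `sorry`).

## What this file does

`ShaIsotropicCasselsTate.lean` (this sub-cell, gen 17) reads the LOWER half off `#Sel^(p)(E/ℚ) = p^d`
+ an isotropic Cassels–Tate pairing on `Ш[p]`. The class-closure lane's second-descent records
(`SecondDescent/BSDpFromSecondDescentNonempty.lean`, cc-eng-4) carry instead the `Ш`-level datum
`#Ш(E/ℚ)[3] = 9`. §1 gives the same road in that currency, class-free:
`missingLowerBoundAt_of_casselsTateIsotropic_of_card_torsionBy` — finite `Ш` (GZK), `#Ш[p] = p^d`,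
a pairing `B : Ш × Ш → ℚ/ℤ` with the PRINTED Cassels–Tate properties (alternating, kernel = divisible
elements; Silverman *AEC* X.4.14) vanishing on `Ш[p]`, and `ord_p #Ш_an ≤ 2d` ⇒
`MissingLowerBoundAt W p` (NO parity step). §2 composes it with the published upper halves of the
supersingular classes at rank `0` (Wuthrich 2014 Prop. 21, `hW` = `sha_dvd_analyticSha`, through
`Typed.X8/X7/X6.bsdp_of_missingLowerBoundAt…`): the X8 ∩ {surj(3)}, X7 ∩ {surj(3)}, X6 twins of
cc-eng-4's `…_of_casselsTate_of_two_nonempty` — a THIRD road for the `B1-ASK-SHA81` rows (33 cells of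
class-closure N6 + the X7/X6 rows), whose certificate is ONE ZERO-type CTP-on-`Sel^(3)` document
(x10 route A `ctp-sel3` / eng-exactrec route B) instead of two `NONEMPTY` witnesses or a `9`-descent
count. Offered by name; those classes are not this sub-cell's; nothing run or booked here.

References: Silverman *AEC* X.4.14, X.4.2 [SilvermanAEC2009]; Cassels 1998 §1 [Cassels1998];
Fisher–Newton 2014 Thm. 1.3 [FisherNewton2014]; Wuthrich 2014 Prop. 21 [Wuthrich2014]; Miller 2011
Def. 1.1 [Miller2011LMS].
-/

noncomputable section

open scoped Classical

open WeierstrassCurve Literature.NumberTheory.EllipticCurves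
  Literature.NumberTheory.EllipticCurves.ModularForms
  Literature.NumberTheory.EllipticCurves.Rank1Residual
  Literature.NumberTheory.EllipticCurves.Rank1Residual.Typed
  Literature.NumberTheory.EllipticCurves.Wuthrich2014
  Literature.GroupTheory.FiniteAbelian

namespace Summit.BirchSwinnertonDyer.Rank1Residual.AdditivePotMult

/-! ### §1 Class-free, `Ш`-level currency -/

section ShaLevel

variable (W : WeierstrassCurve ℚ) [W.IsElliptic] (p : ℕ) [hp : Fact p.Prime]

omit [W.IsElliptic] in
/-- **`p^{2d} ∣ #Ш(E/ℚ)` in `shaOrder` spelling** from finite `Ш`, `#Ш[p] = p^d` and an isotropic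
pairing with the printed Cassels–Tate properties (binder `hCT0`). Class-free; per pair.
[cite: SilvermanAEC2009, Thm. X.4.14] [cite: Cassels1998, §1] -/
theorem pow_two_mul_dvd_shaOrder_of_casselsTateIsotropic_of_card_torsionBy (hfin : W.ShaFinite)
    {d : ℕ} (hcard : Nat.card (AddSubgroup.torsionBy W.sha (p : ℤ)) = p ^ d)
    (hCT0 : ∃ B : W.sha →+ W.sha →+ AddCircle (1 : ℚ), (∀ x, B x x = 0) ∧
      (∀ x, (∀ y, B x y = 0) ↔ x ∈ AddSubgroup.divisibleElements W.sha) ∧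
      ∀ x y : W.sha, p • x = 0 → p • y = 0 → B x y = 0) :
    p ^ (2 * d) ∣ W.shaOrder := by
  haveI : Finite W.sha := hfin
  obtain ⟨B, halt, hker, hiso⟩ := hCT0
  exact W.pow_two_mul_dvd_card_sha_of_casselsTateIsotropic p hcard B halt hker
    (isotropic_torsionBy_of_forall_nsmul W p B hiso)

/-- **The typed LOWER half from `#Ш[p] = p^d` + isotropy + `ord_p #Ш_an ≤ 2d`**, analytic rank
`≤ 1` (`Ш` finite by GZK). NO parity step, NO appeal to the named Cassels–Tate fact. Class-free;
per pair. [cite: Miller2011LMS, Def. 1.1] [cite: SilvermanAEC2009, Thm. X.4.14] -/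
theorem missingLowerBoundAt_of_casselsTateIsotropic_of_card_torsionBy
    (hGZK : rank_eq_analyticRank_of_analyticRank_le_one) (hr : W.analyticRank ≤ 1)
    {d : ℕ} (hcard : Nat.card (AddSubgroup.torsionBy W.sha (p : ℤ)) = p ^ d)
    (hCT0 : ∃ B : W.sha →+ W.sha →+ AddCircle (1 : ℚ), (∀ x, B x x = 0) ∧
      (∀ x, (∀ y, B x y = 0) ↔ x ∈ AddSubgroup.divisibleElements W.sha) ∧
      ∀ x y : W.sha, p • x = 0 → p • y = 0 → B x y = 0)
    {q : ℚ} (hq : shaAn W = (q : ℂ)) (hv : padicValRat p q ≤ 2 * d) :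
    MissingLowerBoundAt W p := by
  have hfin : W.ShaFinite := (hGZK W hr).2
  have hdvd := pow_two_mul_dvd_shaOrder_of_casselsTateIsotropic_of_card_torsionBy W p hfin hcard hCT0
  have hn : W.shaOrder ≠ 0 := (WeierstrassCurve.shaOrder_pos W hfin).ne'
  have hle : 2 * d ≤ padicValNat p W.shaOrder := (padicValNat_dvd_iff_le hn).mp hdvd
  refine ⟨q, hq, hv.trans ?_⟩
  exact_mod_cast hle

end ShaLevel

/-! ### §2 Twins for the supersingular classes at `p = 3`, rank `0`, `ord₃ #Ш_an ≤ 4` (offered) -/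

section Supersingular

/-- **X8 ∩ {r_an = 0} ∩ {surj(3)}, `#Ш[3] = 9`, ZERO Cassels–Tate pairing on `Ш[3]`,
`ord₃ #Ш_an ≤ 4` ⇒ `BSD(E,3)`** — upper half Wuthrich 2014 Prop. 21 (`hW`) via
`Typed.X8.bsdp_of_missingLowerBoundAt_of_surj`; lower half §1. The isotropic-CTP twin of cc-eng-4's
`SecondDescent.X8.bsdp_three_rankZero_of_casselsTate_of_two_nonempty_of_surj` (same rows:
class-closure `B1-ASK-SHA81`). Per pair; nothing booked. [cite: Wuthrich2014, Prop. 21 (p. 400)]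
[cite: SilvermanAEC2009, Thm. X.4.14] [cite: Miller2011LMS, §1 and Def. 1.1] -/
theorem X8.bsdp_three_rankZero_of_casselsTateIsotropic_of_card_torsionBy_of_surj
    (hW : sha_dvd_analyticSha) (hGZK : rank_eq_analyticRank_of_analyticRank_le_one)
    (hmod : hasEntireLFunction_rat) (W : WeierstrassCurve ℚ) [W.IsElliptic] [W.IsGloballyMinimal]
    (hX : ClassX8 W 3) (hs : Surj W 3) (hr : W.analyticRank = 0)
    (hcard : Nat.card (AddSubgroup.torsionBy W.sha (3 : ℤ)) = 9)
    (hCT0 : ∃ B : W.sha →+ W.sha →+ AddCircle (1 : ℚ), (∀ x, B x x = 0) ∧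
      (∀ x, (∀ y, B x y = 0) ↔ x ∈ AddSubgroup.divisibleElements W.sha) ∧
      ∀ x y : W.sha, 3 • x = 0 → 3 • y = 0 → B x y = 0)
    {q : ℚ} (hq : shaAn W = (q : ℂ)) (hv : padicValRat 3 q ≤ 4) : BSDp W 3 :=
  haveI : Fact (Nat.Prime 3) := ⟨Nat.prime_three⟩
  X8.bsdp_of_missingLowerBoundAt_of_surj W 3 hW hGZK hmod hX hs hr
    (missingLowerBoundAt_of_casselsTateIsotropic_of_card_torsionBy W 3 hGZK (by omega) (d := 2)
      (by rw [show ((3 : ℕ) : ℤ) = 3 by norm_num, hcard]; norm_num) (by exact_mod_cast hCT0) hq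
      (by simpa using hv))

/-- **X7 ∩ {r_an = 0}, surj(3), `#Ш[3] = 9`, ZERO Cassels–Tate pairing on `Ш[3]`, `ord₃ #Ш_an ≤ 4`
⇒ `BSD(E,3)`** — twin of `SecondDescent.X7.bsdp_three_rankZero_of_casselsTate_of_two_nonempty_of_surj`.
Per pair; nothing booked. [cite: Wuthrich2014, Prop. 21 (p. 400)] [cite: SilvermanAEC2009, Thm. X.4.14]
[cite: Miller2011LMS, §1 and Def. 1.1] -/
theorem X7.bsdp_three_rankZero_of_casselsTateIsotropic_of_card_torsionBy_of_surj
    (hW : sha_dvd_analyticSha) (hGZK : rank_eq_analyticRank_of_analyticRank_le_one)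
    (hmod : hasEntireLFunction_rat) (W : WeierstrassCurve ℚ) [W.IsElliptic] [W.IsGloballyMinimal]
    (hX : ClassX7 W 3) (hs : Surj W 3) (hr : W.analyticRank = 0)
    (hcard : Nat.card (AddSubgroup.torsionBy W.sha (3 : ℤ)) = 9)
    (hCT0 : ∃ B : W.sha →+ W.sha →+ AddCircle (1 : ℚ), (∀ x, B x x = 0) ∧
      (∀ x, (∀ y, B x y = 0) ↔ x ∈ AddSubgroup.divisibleElements W.sha) ∧
      ∀ x y : W.sha, 3 • x = 0 → 3 • y = 0 → B x y = 0)
    {q : ℚ} (hq : shaAn W = (q : ℂ)) (hv : padicValRat 3 q ≤ 4) : BSDp W 3 :=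
  haveI : Fact (Nat.Prime 3) := ⟨Nat.prime_three⟩
  X7.bsdp_of_missingLowerBoundAt_of_surj W 3 hW hGZK hmod (by norm_num) hX hs hr
    (missingLowerBoundAt_of_casselsTateIsotropic_of_card_torsionBy W 3 hGZK (by omega) (d := 2)
      (by rw [show ((3 : ℕ) : ℤ) = 3 by norm_num, hcard]; norm_num) (by exact_mod_cast hCT0) hq
      (by simpa using hv))

/-- **X6 ∩ {r_an = 0}, `#Ш[3] = 9`, ZERO Cassels–Tate pairing on `Ш[3]`, `ord₃ #Ш_an ≤ 4` ⇒ `BSD(E,3)`**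
— twin of `SecondDescent.X6.bsdp_three_rankZero_of_casselsTate_of_two_nonempty` (the three X6 rows
`152330l1 271726d1 405130d1` of `B1-ASK-SHA81` are its EVIDENCE pointers; nothing run). Per pair.
[cite: Wuthrich2014, Prop. 21 (p. 400)] [cite: SilvermanAEC2009, Thm. X.4.14] [cite: Miller2011LMS, §1 and Def. 1.1] -/
theorem X6.bsdp_three_rankZero_of_casselsTateIsotropic_of_card_torsionBy
    (hW : sha_dvd_analyticSha) (hGZK : rank_eq_analyticRank_of_analyticRank_le_one)
    (hmod : hasEntireLFunction_rat) (W : WeierstrassCurve ℚ) [W.IsElliptic] [W.IsGloballyMinimal]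
    (hX : ClassX6 W 3) (hr : W.analyticRank = 0)
    (hcard : Nat.card (AddSubgroup.torsionBy W.sha (3 : ℤ)) = 9)
    (hCT0 : ∃ B : W.sha →+ W.sha →+ AddCircle (1 : ℚ), (∀ x, B x x = 0) ∧
      (∀ x, (∀ y, B x y = 0) ↔ x ∈ AddSubgroup.divisibleElements W.sha) ∧
      ∀ x y : W.sha, 3 • x = 0 → 3 • y = 0 → B x y = 0)
    {q : ℚ} (hq : shaAn W = (q : ℂ)) (hv : padicValRat 3 q ≤ 4) : BSDp W 3 :=
  haveI : Fact (Nat.Prime 3) := ⟨Nat.prime_three⟩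
  X6.bsdp_of_missingLowerBoundAt_of_analyticRank_eq_zero W 3 hW hGZK hmod (by norm_num) hX hr
    (missingLowerBoundAt_of_casselsTateIsotropic_of_card_torsionBy W 3 hGZK (by omega) (d := 2)
      (by rw [show ((3 : ℕ) : ℤ) = 3 by norm_num, hcard]; norm_num) (by exact_mod_cast hCT0) hq
      (by simpa using hv))

end Supersingular

/-! ### §3 (appended, gen 17) The DOCUMENT shape — two Selmer-basis images and four printed zeros

The ctp-sel3 document (x10 `g8/ctp-sel3/FORMAT.md` C0–C7) prints, for an `𝔽₃`-basis `η₁, η₂` of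
`Sel^(3)(E/ℚ)`, the Gram matrix `(⟨ηᵢ, ηⱼ⟩)`. At rank `0` with `E(ℚ)[p] = 0` the images
`x₁, x₂ ∈ Ш(E/ℚ)[p]` are non-zero and independent and `#Ш[p] = #Sel^(p) = p²`, so four printed zeros
make the pairing vanish on ALL of `Ш[p]` (`isotropic_of_gram_zero_pair`, sibling TOOL file). The
theorems below take the binders in exactly that shape — `B` with the printed Cassels–Tate properties,
`x₁ ≠ 0`, `x₂ ∉ ℤ∙x₁`, `p • xᵢ = 0`, `B xᵢ xⱼ = 0` — the ZERO-matrix counterpart of x10's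
`X10.bsdp_of_ctpGram_of_card_selmerGroup` (`[0 g; g′ 0]`, `g, g′ ≠ 0`). Per pair; nothing booked. -/

section DocumentShape

variable (W : WeierstrassCurve ℚ) [W.IsElliptic] (p : ℕ) [hp : Fact p.Prime]

/-- **Class-free: the typed LOWER half from `#Sel^(p) = p²` and a ZERO Gram matrix on two independent
`p`-torsion classes** of a pairing with the printed Cassels–Tate properties; analytic rank `0`,
`p ∤ #E(ℚ)_tors`, `ord_p #Ш_an ≤ 4`. [cite: Cassels1998, §1] [cite: FisherNewton2014, Thm. 1.3]
[cite: SilvermanAEC2009, Thm. X.4.14 and Thm. X.4.2(a)] [cite: Miller2011LMS, Def. 1.1] -/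
theorem missingLowerBoundAt_of_ctpGramZero_of_card_selmerGroup
    (hGZK : rank_eq_analyticRank_of_analyticRank_le_one) (hr : W.analyticRank = 0)
    (htors : ¬ p ∣ W.torsionOrder) (hSel : Nat.card (W.selmerGroup (p : ℤ)) = p ^ 2)
    (B : W.sha →+ W.sha →+ AddCircle (1 : ℚ)) (halt : ∀ x, B x x = 0)
    (hker : ∀ x, (∀ y, B x y = 0) ↔ x ∈ AddSubgroup.divisibleElements W.sha)
    {x₁ x₂ : W.sha} (hx₁ : p • x₁ = 0) (hx₂ : p • x₂ = 0) (hne : x₁ ≠ 0)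
    (hind : x₂ ∉ AddSubgroup.zmultiples x₁)
    (h₁₁ : B x₁ x₁ = 0) (h₁₂ : B x₁ x₂ = 0) (h₂₁ : B x₂ x₁ = 0) (h₂₂ : B x₂ x₂ = 0)
    {q : ℚ} (hq : shaAn W = (q : ℂ)) (hv : padicValRat p q ≤ 4) : MissingLowerBoundAt W p := by
  have hr1 : W.analyticRank ≤ 1 := by rw [hr]; norm_num
  have hrank : W.mordellWeilRank = 0 := by rw [(hGZK W hr1).1, hr]
  have hfin : W.ShaFinite := (hGZK W hr1).2
  haveI : Finite W.sha := hfin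
  have hcard : Nat.card (AddSubgroup.torsionBy W.sha (p : ℤ)) = p ^ 2 :=
    (card_torsionBy_sha_eq_card_selmerGroup_of_rankZero W p hrank htors).trans hSel
  have hiso := isotropic_of_gram_zero_pair hp.out B hcard hx₁ hx₂ hne hind h₁₁ h₁₂ h₂₁ h₂₂
  have hdvd : p ^ (2 * 2) ∣ W.shaOrder :=
    W.pow_two_mul_dvd_card_sha_of_casselsTateIsotropic p hcard B halt hker hiso
  have hn : W.shaOrder ≠ 0 := (WeierstrassCurve.shaOrder_pos W hfin).ne'
  have hle : 2 * 2 ≤ padicValNat p W.shaOrder := (padicValNat_dvd_iff_le hn).mp hdvd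
  refine ⟨q, hq, hv.trans ?_⟩
  exact_mod_cast hle

end DocumentShape

section DocumentShapeX4M

open Additive GaloisImage

variable {W : WeierstrassCurve ℚ} [W.IsElliptic] [W.IsGloballyMinimal]

/-- **X4(M) ∧ surj(3) ∧ `r_an = 0`, the DOCUMENT shape: `#Sel^(3)(E/ℚ) = 9`, a pairing on `Ш(E/ℚ)`
with the printed Cassels–Tate properties whose Gram matrix on two independent `3`-torsion classes
`x₁, x₂` (the images of the document's Selmer basis) is ZERO, and `ord₃ #Ш_an ≤ 4` ⇒ `BSD(E,3)`.**
Upper half A123 (`ClassX4M.bsdp_three_rankZero_of_surj_of_lower`: Delbourgo Prop. 4, GZK,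
modularity, Wuthrich Lemma 20, Kato `ω`-component). Per pair; NOT a class theorem.
[cite: Delbourgo1998, Prop. 4 (p. 144)] [cite: Wuthrich2014, Lemma 20 (p. 399), Cor. 19 (p. 398)]
[cite: FisherNewton2014, Thm. 1.3] [cite: SilvermanAEC2009, Thm. X.4.14 and Thm. X.4.2(a)] -/
theorem ClassX4M.bsdp_three_rankZero_of_surj_of_ctpGramZero_of_card_selmerThree
    (hDel : Delbourgo1998.prop4_rankZero_pow_dvd_constantCoeff)
    (hGZK : rank_eq_analyticRank_of_analyticRank_le_one) (hmod : hasEntireLFunction_rat)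
    (hmodD : nonempty_modularParametrizationData)
    (hL20 : Wuthrich2014.lemma20_surjective_threeAdic_of_semistable)
    (hKato : Wuthrich2014.kato_minusEigenCharIdeal_dvd_cyclotomicThree_of_surjective)
    (hX : ClassX4M W 3) (hr : W.analyticRank = 0) (hsurj : Surj W 3)
    (hSel : Nat.card (W.selmerGroup (3 : ℤ)) = 9)
    (B : W.sha →+ W.sha →+ AddCircle (1 : ℚ)) (halt : ∀ x, B x x = 0)
    (hker : ∀ x, (∀ y, B x y = 0) ↔ x ∈ AddSubgroup.divisibleElements W.sha)
    {x₁ x₂ : W.sha} (hx₁ : 3 • x₁ = 0) (hx₂ : 3 • x₂ = 0) (hne : x₁ ≠ 0)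
    (hind : x₂ ∉ AddSubgroup.zmultiples x₁)
    (h₁₁ : B x₁ x₁ = 0) (h₁₂ : B x₁ x₂ = 0) (h₂₁ : B x₂ x₁ = 0) (h₂₂ : B x₂ x₂ = 0)
    {q : ℚ} (hq : shaAn W = (q : ℂ)) (hv : padicValRat 3 q ≤ 4) : BSDp W 3 :=
  haveI : Fact (Nat.Prime 3) := ⟨Nat.prime_three⟩
  ClassX4M.bsdp_three_rankZero_of_surj_of_lower hDel hGZK hmod hmodD hL20 hKato hX hr hsurj
    (missingLowerBoundAt_of_ctpGramZero_of_card_selmerGroup W 3 hGZK hr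
      (Supersingular.not_dvd_torsionOrder_of_irr W 3 hX.irr)
      (by rw [show (3 : ℕ) ^ 2 = 9 by norm_num]; exact_mod_cast hSel) B halt hker
      (by exact_mod_cast hx₁) (by exact_mod_cast hx₂) hne hind h₁₁ h₁₂ h₂₁ h₂₂ hq hv)

/-- The DOCUMENT shape with surj(3) decided by `3 ∤ ord₃ j(E)`. [cite: SilvermanATAEC1994, V.6 Prop. 6.1 (p. 410) and V.5.3]
[cite: FisherNewton2014, Thm. 1.3] [cite: SilvermanAEC2009, Thm. X.4.14] -/
theorem ClassX4M.bsdp_three_rankZero_of_not_dvd_padicValRat_j_of_ctpGramZero_of_card_selmerThree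
    (hDel : Delbourgo1998.prop4_rankZero_pow_dvd_constantCoeff)
    (hGZK : rank_eq_analyticRank_of_analyticRank_le_one) (hmod : hasEntireLFunction_rat)
    (hmodD : nonempty_modularParametrizationData)
    (hL20 : Wuthrich2014.lemma20_surjective_threeAdic_of_semistable)
    (hKato : Wuthrich2014.kato_minusEigenCharIdeal_dvd_cyclotomicThree_of_surjective)
    (hX : ClassX4M W 3) (hr : W.analyticRank = 0) (hj : ¬ (3 : ℤ) ∣ padicValRat 3 W.j)
    (hSel : Nat.card (W.selmerGroup (3 : ℤ)) = 9)
    (B : W.sha →+ W.sha →+ AddCircle (1 : ℚ)) (halt : ∀ x, B x x = 0)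
    (hker : ∀ x, (∀ y, B x y = 0) ↔ x ∈ AddSubgroup.divisibleElements W.sha)
    {x₁ x₂ : W.sha} (hx₁ : 3 • x₁ = 0) (hx₂ : 3 • x₂ = 0) (hne : x₁ ≠ 0)
    (hind : x₂ ∉ AddSubgroup.zmultiples x₁)
    (h₁₁ : B x₁ x₁ = 0) (h₁₂ : B x₁ x₂ = 0) (h₂₁ : B x₂ x₁ = 0) (h₂₂ : B x₂ x₂ = 0)
    {q : ℚ} (hq : shaAn W = (q : ℂ)) (hv : padicValRat 3 q ≤ 4) : BSDp W 3 :=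
  haveI : Fact (Nat.Prime 3) := ⟨Nat.prime_three⟩
  ClassX4M.bsdp_three_rankZero_of_surj_of_ctpGramZero_of_card_selmerThree hDel hGZK hmod hmodD hL20
    hKato hX hr (ClassX4M.surj_of_not_dvd_padicValRat_j hX hj) hSel B halt hker hx₁ hx₂ hne hind h₁₁
    h₁₂ h₂₁ h₂₂ hq hv

end DocumentShapeX4M

end Summit.BirchSwinnertonDyer.Rank1Residual.AdditivePotMult

end
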